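import Mathlib
import Literature.MathematicalPhysics.QuantumFieldTheory.Balaban1983to89.B9Thm314ResolventTwoMetric
import Literature.MathematicalPhysics.QuantumFieldTheory.Balaban1983to89.B6DomainMajorant

/-!
# `Balaban1983to89.B9Thm314Combine` — [Balaban1985BackgroundPropagators] Theorem 3.14 (pp. 426–427, (3.154)), the LAST STEP of the resolvent route: the characteristic
# factor (from the plain two-term bound of the two operators) and the additional factor (from a resolvent engine) COMBINED into the printed product shape
# «characteristic inequality × exp(−δ₀d(y, y′, Ω))» by `min ≤ geometric mean` — carrier-free, over [4]'s block majorants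

B9 = T. Bałaban, *Propagators for lattice gauge theories in a background field*, Commun. Math. Phys. **99** (1985) 389–434 [Balaban1985BackgroundPropagators]; [4] =
[Balaban1984PropagatorsII] (2.51)–(2.55) p. 232.  DAG node N06, seat `pub-ymgap-dag-n06-a`; design note `B9-PIN-DESIGN-g2.md` §8 (t314 route of record).  Companions:
`B9Thm314ResolventCore ∕ …Weighted ∕ …TwoMetric ∕ …TwoMetricWeighted` (the additional factor), `B6MajorantReblock`, `B9Thm314ExtraFactor`.

WHAT IS PROVED (kernel; no `sorry`; bookkeeping over `B6RandomWalk.HasMajorant`):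
* (majorants of `−T`, `T₁ − T₂` are the tree's `B6DomainMajorant.hasMajorant_neg∕_sub`, used by name);
* `hasMajorant_sub_plain` — THE PLAIN TWO-TERM BOUND (β): `K₁ ≤ C₁w(a)e^{−δd}`, `K₂ ≤ C₂w(a)e^{−δd}` ⇒ `T₁ − T₂` has majorant `(C₁ + C₂)w(a)e^{−δd}`;
* `hasMajorant_thm314_combined` — (β) AND a majorant `C_R·w(a)·e^{−δ′F(a,b)}` of the same difference (a resolvent engine's output, characteristic decay dropped) ⇒ the
  PRODUCT SHAPE `√((C₁+C₂)C_R)·w(a)·e^{−(δ/2)d(a,b)}·e^{−(δ′/2)F(a,b)}` — the typed `IneqSupF` form of Thm 3.14's sup entry up to the pin's reading of `KernelFamily.e`.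
HONEST SCOPE: bookkeeping; rates halve («after adjusting a definition of δ₀», p. 427); count-neutral; NOT continuum ∕ Clay.
-/

namespace Literature.MathematicalPhysics.QuantumFieldTheory.Balaban1983to89.B9Thm314Combine

open Finset
open Literature.MathematicalPhysics.QuantumFieldTheory.Balaban1983to89.B6RandomWalk (HasMajorant hasMajorant_mono hasMajorant_add)
open Literature.MathematicalPhysics.QuantumFieldTheory.Balaban1983to89.B9Thm314ResolventTwoMetric (hasMajorant_geomMean sqrt_exp_mul_exp)
open Literature.MathematicalPhysics.QuantumFieldTheory.Balaban1983to89.B6DomainMajorant (hasMajorant_sub)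

variable {g : B6.Geometry} {X : Type}

/-- **(β) THE PLAIN TWO-TERM BOUND**: the difference of two operators obeying the characteristic sup bound obeys it with the constants added
(`|((G′ − G̃′)λ)(x)| ≤ |G′λ(x)| + |G̃′λ(x)|`). [cite: Balaban1985BackgroundPropagators, Thm 3.1 (3.42) p.397 applied to both sequences (bookkeeping)] -/
theorem hasMajorant_sub_plain (blk : X → g.Site) {T₁ T₂ : Module.End ℝ (X → ℝ)} {K₁ K₂ : g.Site → g.Site → ℝ} (h₁ : HasMajorant blk T₁ K₁)
    (h₂ : HasMajorant blk T₂ K₂) {C₁ C₂ δ : ℝ} (w : g.Site → ℝ) (dd : g.Site → g.Site → ℝ)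
    (hK₁ : ∀ a b, K₁ a b ≤ C₁ * w a * Real.exp (-(δ * dd a b))) (hK₂ : ∀ a b, K₂ a b ≤ C₂ * w a * Real.exp (-(δ * dd a b))) :
    HasMajorant blk (T₁ - T₂) (fun a b => (C₁ + C₂) * w a * Real.exp (-(δ * dd a b))) := by
  refine hasMajorant_mono blk (hasMajorant_sub blk h₁ h₂) fun a b => ?_
  have := add_le_add (hK₁ a b) (hK₂ a b)
  linarith

/-- **THEOREM 3.14's PRODUCT SHAPE by `min ≤ geometric mean`**: the plain bound `(C₁+C₂)w(a)e^{−δd(a,b)}` (β) and a resolvent bound `C_R·w(a)·e^{−δ′F(a,b)}` of the same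
difference give the majorant `√((C₁+C₂)·C_R)·w(a)·e^{−(δ/2)d(a,b)}·e^{−(δ′/2)F(a,b)}` — characteristic factor × additional factor (3.154), both at half rate («after adjusting a
definition of δ₀», p. 427). [cite: Balaban1985BackgroundPropagators, Thm 3.14 (3.154) pp.426–427 (bookkeeping: the combination step of the resolvent route)] -/
theorem hasMajorant_thm314_combined (blk : X → g.Site) {T : Module.End ℝ (X → ℝ)} {Kβ KR : g.Site → g.Site → ℝ}
    (hβ : HasMajorant blk T Kβ) (hR : HasMajorant blk T KR) {Cβ CR δ δ' : ℝ} (hCβ : 0 ≤ Cβ) (hCR : 0 ≤ CR) (w : g.Site → ℝ) (hw : ∀ a, 0 ≤ w a)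
    (dd F : g.Site → g.Site → ℝ) (hKβ0 : ∀ a b, 0 ≤ Kβ a b) (hKR0 : ∀ a b, 0 ≤ KR a b)
    (hKβ : ∀ a b, Kβ a b ≤ Cβ * w a * Real.exp (-(δ * dd a b))) (hKR : ∀ a b, KR a b ≤ CR * w a * Real.exp (-(δ' * F a b))) :
    HasMajorant blk T (fun a b => Real.sqrt (Cβ * CR) * w a * Real.exp (-(δ / 2 * dd a b)) * Real.exp (-(δ' / 2 * F a b))) := by
  refine hasMajorant_mono blk (hasMajorant_geomMean blk hβ hR hKβ0 hKR0) fun a b => ?_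
  have hprod : Kβ a b * KR a b ≤ (Cβ * w a * Real.exp (-(δ * dd a b))) * (CR * w a * Real.exp (-(δ' * F a b))) :=
    mul_le_mul (hKβ a b) (hKR a b) (hKR0 a b) (mul_nonneg (mul_nonneg hCβ (hw a)) (Real.exp_nonneg _))
  refine (Real.sqrt_le_sqrt hprod).trans (le_of_eq ?_)
  -- √((Cβ w e^{−δd}) (CR w e^{−δ′F})) = √(Cβ CR) · w · e^{−δd/2} · e^{−δ′F/2}
  have hre : Cβ * w a * Real.exp (-(δ * dd a b)) * (CR * w a * Real.exp (-(δ' * F a b))) =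
      (Cβ * w a) * Real.exp (-(δ * dd a b)) * ((CR * w a) * Real.exp (-(δ' * F a b))) := by ring
  rw [hre, sqrt_exp_mul_exp (mul_nonneg hCβ (hw a)) (mul_nonneg hCR (hw a))]
  have hww : Real.sqrt (Cβ * w a * (CR * w a)) = Real.sqrt (Cβ * CR) * w a := by
    rw [show Cβ * w a * (CR * w a) = (Cβ * CR) * (w a * w a) by ring, Real.sqrt_mul (mul_nonneg hCβ hCR), Real.sqrt_mul_self (hw a)]
  rw [hww]
  ring_nf

end Literature.MathematicalPhysics.QuantumFieldTheory.Balaban1983to89.B9Thm314Combine
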